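import Literature.AlgebraicGeometry.Motives.LefschetzClassesPowersOfCurve
import Literature.AlgebraicGeometry.Motives.EndomorphismAlgebraActsOnH1
import Literature.AlgebraicGeometry.Motives.BaseChangeAlongInverse
import Mathlib.FieldTheory.IsAlgClosed.Basic
import HarnessLib

/-!
# Lenstra–Zarhin for supersingular abelian varieties, reduced to Deuring's theorem

Final assembly for the named fact `LenstraZarhin1993_supersingular_lefschetzClasses_eq_top`
(`Motives/SupersingularAbelianVariety`; Lenstra–Zarhin 1993, §1, p. 179: on a supersingular
abelian variety over an algebraically closed field every even-degree cohomology class is a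
Lefschetz class), for an arbitrary Weil cohomology theory `W` (Kleiman 1968, §1.2):

* `WeilCohomology.lefschetzClasses_eq_top_of_iso`: Lefschetz classes transfer along isomorphisms
  of `k`-schemes;
* `LenstraZarhin1993_supersingular_lefschetzClasses_eq_top_of_deuring`: **the named fact holds
  for every `A` granted Deuring's theorem** in ring-theoretic form for the supersingular elliptic
  curves `E` over `k̄ = AlgebraicClosure k` occurring in the definition of supersingularity
  (`E[p](k̄) = 0`, `dim E = 1` ⟹ `End⁰(E)` is a finite-dimensional central simple `ℚ`-algebra of
  dimension `4`, i.e. a quaternion algebra: M. Deuring, *Die Typen der Multiplikatorenringe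
  elliptischer Funktionenkörper*, Abh. Math. Sem. Hamburg 14 (1941); Silverman, *AEC* V.3.1).

The proof chains the tree's theorems: `dim A = 0` is `…_of_dim_eq_zero`; for `dim A = g + 1`,
`A ⊗ k̄ ∼ E^{g+1}` by definition; since `k` is algebraically closed, `k ≅ k̄` and base change
back to `k` is an equivalence (`Motives/BaseChangeAlongInverse`): `E' = E ×_{k̄} k` is a
one-dimensional abelian variety over `k` with `End E' ≅ End E`, so Deuring's data transfer to
`End⁰(E')` (`endAlgebra.transfer`) and the `f*|H¹(E')` span `End_K H¹(E')`
(`span_pullback_one_eq_top_of_endAlgebra`); hence all classes on `E'^{g+1}` are Lefschetz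
(`lefschetzClasses_powSucc_eq_top`: graph classes span `H²`, exterior algebra and polarization
give `H²ʳ`), and they transfer to `(E^{g+1}) ×_{k̄} k ≅ E'^{g+1}`, along the base-changed isogeny
to `(A ⊗ k̄) ×_{k̄} k` (`lefschetzClasses_eq_top_of_isIsogenous`, quasi-inverses of isogenies),
and finally to `A ≅ (A ⊗ k̄) ×_{k̄} k`.

## References

* [LenstraZarhin1993] H. W. Lenstra, Jr., Yu. G. Zarhin, *The Tate conjecture for almost ordinary
  abelian varieties over finite fields*, Advances in Number Theory (1993), §1, p. 179.
* [SilvermanAEC2009] J. H. Silverman, *The Arithmetic of Elliptic Curves*, 2nd ed., Thm. V.3.1.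
* [Kleiman1968] S. Kleiman, *Algebraic cycles and the Weil conjectures* (1968), §1.2.
-/

noncomputable section

universe u v

open CategoryTheory AlgebraicGeometry

namespace Literature.AlgebraicGeometry.Motives

variable {k : Type u} [Field k] {K : Type v} [Field K] [CharZero K] (W : WeilCohomology k K)

namespace WeilCohomology

/-- **Lefschetz classes transfer along an isomorphism** of smooth projective `k`-schemes
(pull-back along an isomorphism is bijective). [cite: Kleiman1968, §1.2] -/
theorem lefschetzClasses_eq_top_of_iso {n m : ℕ} {X Y : SchemeOver k}
    (hX : IsSmoothProjective n X) (hY : IsSmoothProjective m Y) (e : X ≅ Y) (r : ℕ)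
    (h : W.lefschetzClasses Y r = ⊤) : W.lefschetzClasses X r = ⊤ :=
  W.lefschetzClasses_eq_top_of_surjective hX hY e.hom r
    (fun x ↦ ⟨W.pullback e.inv (2 * r) x, by
      rw [← LinearMap.comp_apply, ← W.pullback_comp, e.hom_inv_id, W.pullback_id,
        LinearMap.id_apply]⟩) h

end WeilCohomology

/-- **Lenstra–Zarhin for supersingular abelian varieties, granted Deuring's theorem.** Let `k`
be algebraically closed, `W` a Weil cohomology theory over `k` and `A` a supersingular abelian
variety over `k` (`A ⊗ k̄ ∼ Eᵍ`, `E[p](k̄) = 0`). If for every supersingular elliptic curve `E`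
over `k̄ = AlgebraicClosure k` the endomorphism algebra `End⁰(E) = ℚ ⊗ End E` is a
finite-dimensional central simple `ℚ`-algebra of dimension `4` (Deuring 1941; Silverman, *AEC*
V.3.1), then every class in every `H²ʳ(A)` is a Lefschetz class (Lenstra–Zarhin 1993, §1,
p. 179). All other inputs are theorems of the tree (see the module docstring).
[cite: LenstraZarhin1993, §1 p. 179] -/
theorem LenstraZarhin1993_supersingular_lefschetzClasses_eq_top_of_deuring (A : AbelianVariety k)
    (hD : ∀ E : AbelianVariety (AlgebraicClosure k), E.IsSupersingularEllipticCurve →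
      E.finiteDimensional_endAlgebra ∧ IsSimpleRing E.endAlgebra ∧
        Algebra.IsCentral ℚ E.endAlgebra ∧ Module.finrank ℚ E.endAlgebra = 4) :
    LenstraZarhin1993_supersingular_lefschetzClasses_eq_top W A := by
  intro _ hA r
  rcases hdim : A.dim with _ | g
  · exact LenstraZarhin1993_supersingular_lefschetzClasses_eq_top_of_dim_eq_zero W A hdim hA r
  obtain ⟨E, hE, hiso⟩ := (AbelianVariety.isSupersingular_iff_of_dim_eq_succ hdim).1 hA
  -- `k ≅ k̄`, and the inverse isomorphism as an algebra structure `k̄ → k`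
  let e : k ≃+* AlgebraicClosure k := RingEquiv.ofBijective (algebraMap k (AlgebraicClosure k))
    (IsAlgClosed.algebraMap_bijective_of_isIntegral (k := k) (K := AlgebraicClosure k))
  letI : Algebra (AlgebraicClosure k) k := e.symm.toRingHom.toAlgebra
  have hk : ∀ x : k, algebraMap (AlgebraicClosure k) k (algebraMap k (AlgebraicClosure k) x) = x :=
    fun x ↦ e.symm_apply_apply x
  have hkb : ∀ y : AlgebraicClosure k,
      algebraMap k (AlgebraicClosure k) (algebraMap (AlgebraicClosure k) k y) = y :=
    fun y ↦ e.apply_symm_apply y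
  -- `E' = E ×_{k̄} k`: a one-dimensional abelian variety over `k` with `End E' ≅ End E`
  have hE'1 : (E.baseChange k).dim = 1 := by rw [AbelianVariety.dim_baseChange]; exact hE.1
  obtain ⟨hfd, hs, hc, h4⟩ := hD E hE
  obtain ⟨hfd', hs', hc', h4'⟩ := AbelianVariety.endAlgebra.transfer
    (AbelianVariety.endRingEquivOfInverse k hkb hk E) hfd hs hc h4
  haveI := hs'
  haveI := hc'
  have hspan := W.span_pullback_one_eq_top_of_endAlgebra (E.baseChange k) hE'1 hfd' h4'
  -- all classes on `E'^{g+1}` are Lefschetz classes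
  have h1 : W.lefschetzClasses ((E.baseChange k).powSucc g).X r = ⊤ :=
    W.lefschetzClasses_powSucc_eq_top (E.baseChange k) hE'1 hspan g r
  -- transfer to `(E^{g+1}) ×_{k̄} k ≅ E'^{g+1}`
  have h2 : W.lefschetzClasses ((E.powSucc g).baseChange k).X r = ⊤ :=
    W.lefschetzClasses_eq_top_of_iso AbelianVariety.isSmoothProjective_holds
      AbelianVariety.isSmoothProjective_holds (AbelianVariety.powSuccBaseChangeXIso k E g) r h1
  -- along the base-changed isogeny `(A ⊗ k̄) ×_{k̄} k → (E^{g+1}) ×_{k̄} k`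
  have h3 : W.lefschetzClasses ((A.baseChange (AlgebraicClosure k)).baseChange k).X r = ⊤ :=
    W.lefschetzClasses_eq_top_of_isIsogenous (AbelianVariety.IsIsogenous.baseChange k hiso) r h2
  -- and back to `A ≅ (A ⊗ k̄) ×_{k̄} k`
  exact W.lefschetzClasses_eq_top_of_iso AbelianVariety.isSmoothProjective_holds
    AbelianVariety.isSmoothProjective_holds
    (AbelianVariety.baseChangeBaseChangeXIso (AlgebraicClosure k) hk hkb A).symm r h3

end Literature.AlgebraicGeometry.Motives

end
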